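import Mathlib
import Literature.Analysis.OperatorTheory.KernelPathIntegralPeeling

/-!
# Cyclic peeling of a COMPLEX transfer kernel — stub `stub_cyclicPeelC` of line `twisted_trace_transfer`
# for crux `QuarksAsStableAction.StableActionBridge` (item stmt-QuantumFields-9737)

This file proves the registered stub `stub_cyclicPeelC` of the lead skeleton of line
`twisted_trace_transfer` (sub-goal A1 of step E3, Layer A): the verbatim port to complex-valued
kernels `K : Y → Y → ℂ` and complex one-site observables `F G : Y → ℂ` (with REAL bounds) of the
real trace formula `Literature.Analysis.OperatorTheory.integral_cyclic_eq_integral_iterate`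
(`Literature/Analysis/OperatorTheory/KernelCyclicPeeling.lean`) together with the peeling lemmas of
`KernelPathIntegralPeeling.lean` it rests on.

For a bounded measurable kernel `K` on a FINITE measure space `(Y, ρ)`, write
`(κ f)(w) = ∫ K(w, z) f(z) dρ(z)` for the pointwise transfer operator and
`W(u, ζ) = ∏_{i : Fin M} K((u ∷ ζ)_i, ζ_i)` (`u ∷ ζ = Fin.cons u ζ`) for the open path weight of a
block of `M` sites with left boundary spin `u`.  The helper lemmas (sub-namespace `StubCyclicPeelC`,
suffix `C`, to avoid clashes with the real originals):

* `integral_pathWeightC_succ_eq` — ONE-STEP PEELING (Markov property):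
  `∫ W(u,ζ) F(ζ) dρ^{⊗(M+1)}(ζ) = ∫ K(u,y) [∫ W(y,ζ') F(y ∷ ζ') dρ^{⊗M}(ζ')] dρ(y)`, by Fubini
  along `Fin.cons` (Mathlib `measurePreserving_piFinSuccAbove _ 0`, bounded integrands on finite
  product measures, `MemLp.of_bound`; the bookkeeping `‖W‖ ≤ C^M` via `Finset.norm_prod_le` and the
  joint measurability of `W` are inlined, the `K`-free `measurable_finCons` of the real file is
  reused);
* `integral_pathWeightC_eq_iterate` — `j`-fold peeling gives the iterate `κ^[j]`;
* `integral_pi_succ_eq_integral_consC` — `∫ Φ dρ^{⊗(M+1)} = ∫ (∫ Φ(y ∷ ζ') dρ^{⊗M}) dρ(y)`;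
* `prod_cyclic_consC` — cutting the cycle at site `0`;
* `integral_pathWeightC_mul_kernel_last_eq_iterate`, `integral_pathWeightC_obs_mul_kernel_last_eq`
  — the closing arc is the iterated kernel `κ^[k] K(·, x)`;
* `integral_cyclic_eq_integral_iterateC` — the TRACE FORMULA on the cycle of
  `N = k + 1 + n' + 1` sites with periodic weight `∏_t K(V t, V (t+1))`, `F` at site `0` and `G`
  at site `p = n' + 1`:
  `∫ F(V 0) G(V p) ∏_t K(V t, V (t+1)) dρ^{⊗N}(V) = ∫ F(x) (κ^[n'+1] (G · κ^[k] K(·, x)))(x) dρ(x)`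
  (the path-space form of `Tr (F 𝕋^{n'+1} G 𝕋^{k+1})`).

The registered statement `stub_cyclicPeelC` is the fully quantified form of the last item.
Everything is measure-theoretic bookkeeping over Mathlib (plus `measurable_finCons` of
`KernelPathIntegralPeeling.lean`); the proofs mirror the real files line by line (`ℝ ↦ ℂ` in
kernel and observables, `norm_mul` / `Finset.norm_prod_le` for the bounds, `integral_const_mul`
over `RCLike`, `one_smul` for the empty block). [folklore]
-/

namespace Summit.QuantumFields.QCD.Cruxes.StableActionBridge.TwistedTraceTransfer

open MeasureTheory Filter Set Function
open scoped InnerProductSpace ComplexConjugate Matrix BigOperators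
open Literature.Analysis.OperatorTheory (measurable_finCons)

namespace StubCyclicPeelC

variable {Y : Type*} [MeasurableSpace Y] {ρ : Measure Y} [IsFiniteMeasure ρ]
  {K : Y → Y → ℂ} {C : ℝ}

/-- **One-step peeling (Markov property of the complex path weight).** For a bounded measurable
complex kernel `K` on a finite measure space, a block of `M + 1` sites with left boundary spin `u`
and a bounded measurable complex function `F` of the block,
`∫ (∏ᵢ K((u∷ζ)ᵢ, ζᵢ)) F(ζ) dρ^{⊗(M+1)}(ζ) = ∫ K(u,y) [∫ (∏ᵢ K((y∷ζ')ᵢ, ζ'ᵢ)) F(y∷ζ') dρ^{⊗M}(ζ')] dρ(y)`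
(Fubini along `Fin.cons`, Mathlib `measurePreserving_piFinSuccAbove`; port of
`integral_pathWeight_succ_eq`). [folklore] -/
theorem integral_pathWeightC_succ_eq (hK : Measurable (uncurry K)) (hC : ∀ x y, ‖K x y‖ ≤ C)
    (M : ℕ) (u : Y) {F : (Fin (M + 1) → Y) → ℂ} (hF : Measurable F) {B : ℝ}
    (hFb : ∀ ζ, ‖F ζ‖ ≤ B) :
    ∫ ζ : Fin (M + 1) → Y, (∏ i : Fin (M + 1),
        K ((Fin.cons u ζ : Fin (M + 2) → Y) (Fin.castSucc i)) (ζ i)) * F ζ ∂(Measure.pi fun _ => ρ) =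
      ∫ y, K u y * ∫ ζ' : Fin M → Y, (∏ i : Fin M,
        K ((Fin.cons y ζ' : Fin (M + 1) → Y) (Fin.castSucc i)) (ζ' i)) *
          F (Fin.cons y ζ') ∂(Measure.pi fun _ => ρ) ∂ρ := by
  set pi : Measure (Fin M → Y) := Measure.pi fun _ => ρ
  have hmp := (measurePreserving_piFinSuccAbove (fun _ : Fin (M + 1) => ρ) 0).symm
  -- the integrand transported to `Y × (Fin M → Y)`
  set G : (Fin (M + 1) → Y) → ℂ := fun ζ =>
    (∏ i : Fin (M + 1), K ((Fin.cons u ζ : Fin (M + 2) → Y) (Fin.castSucc i)) (ζ i)) * F ζ with hG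
  have hcons : ∀ (y : Y) (ζ' : Fin M → Y),
      G (Fin.cons y ζ') = K u y * ((∏ i : Fin M,
        K ((Fin.cons y ζ' : Fin (M + 1) → Y) (Fin.castSucc i)) (ζ' i)) * F (Fin.cons y ζ')) := by
    intro y ζ'
    rw [hG]
    dsimp only
    rw [Fin.prod_univ_succ]
    simp only [Fin.cons_zero, Fin.cons_succ, Fin.castSucc_zero, ← Fin.succ_castSucc]
    ring
  have he : ∀ p : Y × (Fin M → Y),
      (MeasurableEquiv.piFinSuccAbove (fun _ : Fin (M + 1) => Y) 0).symm p = Fin.cons p.1 p.2 := by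
    intro p
    simp only [MeasurableEquiv.piFinSuccAbove_symm_apply, Fin.insertNthEquiv, Fin.insertNth_zero,
      Equiv.coe_fn_mk]
    rfl
  -- change of variables
  have h1 : ∫ ζ, G ζ ∂(Measure.pi fun _ : Fin (M + 1) => ρ) =
      ∫ p, G (Fin.cons p.1 p.2) ∂(ρ.prod pi) := by
    rw [← hmp.integral_comp']
    refine integral_congr_ae (Eventually.of_forall fun p => ?_)
    dsimp only
    rw [he]
  rw [h1]
  -- Fubini
  have hcm : Measurable fun p : Y × (Fin M → Y) => (Fin.cons p.1 p.2 : Fin (M + 1) → Y) :=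
    measurable_finCons M
  -- joint measurability of the path weight (as in the real `measurable_pathWeight`)
  have hGm : Measurable G := by
    rw [hG]
    refine Measurable.mul (Finset.measurable_prod _ fun i _ => ?_) hF
    have h1 : Measurable fun ζ : Fin (M + 1) → Y =>
        (Fin.cons u ζ : Fin (M + 2) → Y) (Fin.castSucc i) :=
      (measurable_pi_apply _).comp ((measurable_finCons (M + 1)).comp
        (measurable_const.prodMk measurable_id))
    exact hK.comp (h1.prodMk (measurable_pi_apply i))
  have hC0 : 0 ≤ C := (norm_nonneg _).trans (hC u u)
  have hB0 : 0 ≤ B := (norm_nonneg _).trans (hFb (Fin.cons u fun _ => u))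
  -- the bound `‖W(u, ζ) F(ζ)‖ ≤ C^(M+1) B` (as in the real `norm_pathWeight_le`)
  have hGb : ∀ ζ, ‖G ζ‖ ≤ C ^ (M + 1) * B := fun ζ => by
    rw [hG]; dsimp only; rw [norm_mul]
    refine mul_le_mul ?_ (hFb ζ) (norm_nonneg _) (by positivity)
    calc ‖∏ i : Fin (M + 1), K ((Fin.cons u ζ : Fin (M + 2) → Y) (Fin.castSucc i)) (ζ i)‖
        ≤ ∏ i : Fin (M + 1), ‖K ((Fin.cons u ζ : Fin (M + 2) → Y) (Fin.castSucc i)) (ζ i)‖ :=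
          Finset.norm_prod_le _ _
      _ ≤ ∏ _i : Fin (M + 1), C :=
          Finset.prod_le_prod (fun i _ => norm_nonneg _) fun i _ => hC _ _
      _ = C ^ (M + 1) := by simp
  have hint : Integrable (fun p : Y × (Fin M → Y) => G (Fin.cons p.1 p.2)) (ρ.prod pi) := by
    have hmeas : AEStronglyMeasurable (fun p : Y × (Fin M → Y) => G (Fin.cons p.1 p.2))
        (ρ.prod pi) :=
      (hGm.comp hcm).aestronglyMeasurable
    exact memLp_one_iff_integrable.1
      (MemLp.of_bound hmeas (C ^ (M + 1) * B) (Eventually.of_forall fun p => hGb _))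
  rw [integral_prod _ hint]
  refine integral_congr_ae (Eventually.of_forall fun y => ?_)
  dsimp only
  simp_rw [hcons]
  rw [integral_const_mul]

/-- **Peeling `j` sites: the path integral is the `j`-th iterate of the complex kernel.** For a
block of `n + j` sites with left boundary spin `u` whose observable `G` only depends on the LAST
`n` sites, `∫ (∏ᵢ K((u∷ζ)ᵢ, ζᵢ)) G(ζ|_{last n}) dρ^{⊗(n+j)} = (κ^j h)(u)` with
`(κ f)(x) = ∫ K(x,y) f(y) dρ(y)` and `h(x) = ∫ (∏ᵢ K((x∷ζ')ᵢ, ζ'ᵢ)) G(ζ') dρ^{⊗n}(ζ')`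
(port of `integral_pathWeight_eq_iterate`). [folklore] -/
theorem integral_pathWeightC_eq_iterate (hK : Measurable (uncurry K)) (hC : ∀ x y, ‖K x y‖ ≤ C)
    (n : ℕ) {G : (Fin n → Y) → ℂ} (hG : Measurable G) {B : ℝ} (hGb : ∀ ζ, ‖G ζ‖ ≤ B) (j : ℕ)
    (u : Y) :
    ∫ ζ : Fin (n + j) → Y, (∏ i : Fin (n + j),
        K ((Fin.cons u ζ : Fin (n + j + 1) → Y) (Fin.castSucc i)) (ζ i)) *
          G (fun i => ζ (i.addNat j)) ∂(Measure.pi fun _ => ρ) =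
      (fun f : Y → ℂ => fun x => ∫ y, K x y * f y ∂ρ)^[j]
        (fun x => ∫ ζ' : Fin n → Y, (∏ i : Fin n,
          K ((Fin.cons x ζ' : Fin (n + 1) → Y) (Fin.castSucc i)) (ζ' i)) * G ζ'
          ∂(Measure.pi fun _ => ρ)) u := by
  induction j generalizing u with
  | zero =>
    simp only [Function.iterate_zero, id_eq]
    rfl
  | succ j ih =>
    have hFm : Measurable fun ζ : Fin (n + j + 1) → Y => G fun i => ζ (i.addNat (j + 1)) :=
      hG.comp (measurable_pi_lambda _ fun i => measurable_pi_apply _)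
    have h1 := integral_pathWeightC_succ_eq (ρ := ρ) hK hC (n + j) u
      (F := fun ζ : Fin (n + j + 1) → Y => G fun i => ζ (i.addNat (j + 1))) hFm (fun ζ => hGb _)
    rw [Function.iterate_succ_apply']
    refine h1.trans ?_
    refine integral_congr_ae (Eventually.of_forall fun y => ?_)
    dsimp only
    -- `(y ∷ ζ') (i.addNat (j+1)) = ζ' (i.addNat j)` holds by computation, so `congr` closes it
    rw [← ih y]
    congr 1

/-- **Fubini along `Fin.cons`** (complex integrand): for a bounded measurable `Φ` on a block of
`M + 1` sites, `∫ Φ dρ^{⊗(M+1)} = ∫ (∫ Φ(y ∷ ζ') dρ^{⊗M}(ζ')) dρ(y)` (Mathlib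
`measurePreserving_piFinSuccAbove` at the pivot `0`; port of `integral_pi_succ_eq_integral_cons`).
[folklore] -/
theorem integral_pi_succ_eq_integral_consC (M : ℕ) {Φ : (Fin (M + 1) → Y) → ℂ}
    (hΦ : Measurable Φ) {B : ℝ} (hΦb : ∀ ζ, ‖Φ ζ‖ ≤ B) :
    ∫ ζ, Φ ζ ∂(Measure.pi fun _ : Fin (M + 1) => ρ) =
      ∫ y, ∫ ζ' : Fin M → Y, Φ (Fin.cons y ζ') ∂(Measure.pi fun _ => ρ) ∂ρ := by
  set pi : Measure (Fin M → Y) := Measure.pi fun _ => ρ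
  have hmp := (measurePreserving_piFinSuccAbove (fun _ : Fin (M + 1) => ρ) 0).symm
  have he : ∀ p : Y × (Fin M → Y),
      (MeasurableEquiv.piFinSuccAbove (fun _ : Fin (M + 1) => Y) 0).symm p = Fin.cons p.1 p.2 := by
    intro p
    simp only [MeasurableEquiv.piFinSuccAbove_symm_apply, Fin.insertNthEquiv, Fin.insertNth_zero,
      Equiv.coe_fn_mk]
    rfl
  have h1 : ∫ ζ, Φ ζ ∂(Measure.pi fun _ : Fin (M + 1) => ρ) =
      ∫ p, Φ (Fin.cons p.1 p.2) ∂(ρ.prod pi) := by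
    rw [← hmp.integral_comp']
    refine integral_congr_ae (Eventually.of_forall fun p => ?_)
    dsimp only
    rw [he]
  rw [h1]
  have hcm : Measurable fun p : Y × (Fin M → Y) => (Fin.cons p.1 p.2 : Fin (M + 1) → Y) :=
    measurable_finCons M
  have hint : Integrable (fun p : Y × (Fin M → Y) => Φ (Fin.cons p.1 p.2)) (ρ.prod pi) :=
    memLp_one_iff_integrable.1
      (MemLp.of_bound (hΦ.comp hcm).aestronglyMeasurable B (Eventually.of_forall fun p => hΦb _))
  rw [integral_prod _ hint]

omit [MeasurableSpace Y] in
/-- **Cutting the cycle at site `0`** (complex kernel). For `V = x ∷ ζ` on the cycle of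
`k + 1 + n' + 1` sites, the periodic weight `∏_t K(V t, V (t + 1))` is the open path weight
`∏ᵢ K((x ∷ ζ)ᵢ, ζᵢ)` times the closing bond `K(ζ_{k+n'}, x)` (the last site is written
`(Fin.last k).addNat n'`; port of `prod_cyclic_cons`). [folklore] -/
theorem prod_cyclic_consC (K : Y → Y → ℂ) (k n' : ℕ) (x : Y) (ζ : Fin (k + 1 + n') → Y) :
    ∏ t : Fin (k + 1 + n' + 1), K ((Fin.cons x ζ : Fin (k + 1 + n' + 1) → Y) t)
        ((Fin.cons x ζ : Fin (k + 1 + n' + 1) → Y) (t + 1)) =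
      (∏ i : Fin (k + 1 + n'),
          K ((Fin.cons x ζ : Fin (k + 1 + n' + 1) → Y) (Fin.castSucc i)) (ζ i)) *
        K (ζ ((Fin.last k).addNat n')) x := by
  rw [Fin.prod_univ_castSucc]
  have hlast : (Fin.last (k + 1 + n') : Fin (k + 1 + n' + 1)) = ((Fin.last k).addNat n').succ :=
    Fin.ext (by simp; omega)
  congr 1
  · refine Finset.prod_congr rfl fun i _ => ?_
    rw [Fin.coeSucc_eq_succ, Fin.cons_succ]
  · rw [Fin.last_add_one, Fin.cons_zero, hlast, Fin.cons_succ]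

/-- **The closing arc is an iterated complex kernel**: for every `x, y`,
`∫ (∏ᵢ K((y ∷ η)ᵢ, ηᵢ)) K((y ∷ η)_{last}, x) dρ^{⊗k}(η) = (κ^[k] K(·, x))(y)` — the `k + 1` bonds
from `y` through the `k` integrated sites to `x` give the iterated kernel `K^{(k+1)}(y, x)`
(port of `integral_pathWeight_mul_kernel_last_eq_iterate`). [folklore] -/
theorem integral_pathWeightC_mul_kernel_last_eq_iterate (hK : Measurable (uncurry K))
    (hC : ∀ x y, ‖K x y‖ ≤ C) (x : Y) (k : ℕ) (y : Y) :
    ∫ η : Fin k → Y, (∏ i : Fin k, K ((Fin.cons y η : Fin (k + 1) → Y) (Fin.castSucc i)) (η i)) *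
        K ((Fin.cons y η : Fin (k + 1) → Y) (Fin.last k)) x ∂(Measure.pi fun _ => ρ) =
      (fun f : Y → ℂ => fun w => ∫ z, K w z * f z ∂ρ)^[k] (fun z => K z x) y := by
  induction k generalizing y with
  | zero =>
    simp only [Finset.univ_eq_empty, Finset.prod_empty, one_mul, Fin.last_zero, Fin.cons_zero,
      Function.iterate_zero, id_eq]
    have : (Measure.pi fun _ : Fin 0 => ρ).real univ = 1 := by
      rw [measureReal_def, Measure.pi_univ]
      simp
    rw [integral_const, this, one_smul]
  | succ k ih =>
    have hKx : Measurable fun z => K z x := hK.comp (measurable_id.prodMk measurable_const)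
    have hFm : Measurable fun η : Fin (k + 1) → Y => K (η (Fin.last k)) x :=
      hKx.comp (measurable_pi_apply _)
    have h1 := integral_pathWeightC_succ_eq (ρ := ρ) hK hC k y
      (F := fun η : Fin (k + 1) → Y => K (η (Fin.last k)) x) hFm (fun η => hC _ _)
    have hlast : ∀ η : Fin (k + 1) → Y,
        (Fin.cons y η : Fin (k + 1 + 1) → Y) (Fin.last (k + 1)) = η (Fin.last k) := fun η => by
      rw [← Fin.succ_last, Fin.cons_succ]
    simp_rw [hlast]
    rw [h1, Function.iterate_succ_apply']
    refine integral_congr_ae (Eventually.of_forall fun w => ?_)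
    dsimp only
    rw [← ih w]

/-- **The block after the first arc** (complex kernel). With the observable `G` at the first
site of a block of `k + 1` sites with boundary spin `z` and the closing bond `K(·_last, x)` at its
last site,
`∫ (∏ᵢ K((z∷η)ᵢ, ηᵢ)) G(η₀) K(η_last, x) dρ^{⊗(k+1)}(η) = ∫ K(z, y) G(y) (κ^[k] K(·, x))(y) dρ(y)`
(one-step peeling, then `integral_pathWeightC_mul_kernel_last_eq_iterate`; port of
`integral_pathWeight_obs_mul_kernel_last_eq`). [folklore] -/
theorem integral_pathWeightC_obs_mul_kernel_last_eq (hK : Measurable (uncurry K))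
    (hC : ∀ x y, ‖K x y‖ ≤ C) (k : ℕ) {G : Y → ℂ} (hG : Measurable G) {BG : ℝ}
    (hGb : ∀ y, ‖G y‖ ≤ BG) (x : Y) :
    (fun z => ∫ η : Fin (k + 1) → Y, (∏ i : Fin (k + 1),
        K ((Fin.cons z η : Fin (k + 1 + 1) → Y) (Fin.castSucc i)) (η i)) *
          (G (η 0) * K (η (Fin.last k)) x) ∂(Measure.pi fun _ => ρ)) =
      fun w => ∫ y, K w y * (G y *
        (fun f : Y → ℂ => fun w => ∫ z, K w z * f z ∂ρ)^[k] (fun z => K z x) y) ∂ρ := by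
  have hKx : Measurable fun z => K z x := hK.comp (measurable_id.prodMk measurable_const)
  have hObsm : Measurable fun η : Fin (k + 1) → Y => G (η 0) * K (η (Fin.last k)) x :=
    (hG.comp (measurable_pi_apply 0)).mul (hKx.comp (measurable_pi_apply _))
  have hObsb : ∀ η : Fin (k + 1) → Y, ‖G (η 0) * K (η (Fin.last k)) x‖ ≤ BG * C := fun η => by
    rw [norm_mul]
    exact mul_le_mul (hGb _) (hC _ _) (norm_nonneg _) ((norm_nonneg _).trans (hGb (η 0)))
  funext z
  rw [integral_pathWeightC_succ_eq (ρ := ρ) hK hC k z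
    (F := fun η : Fin (k + 1) → Y => G (η 0) * K (η (Fin.last k)) x) hObsm hObsb]
  refine integral_congr_ae (Eventually.of_forall fun y => ?_)
  dsimp only
  simp only [Fin.cons_zero]
  congr 1
  rw [← integral_pathWeightC_mul_kernel_last_eq_iterate (ρ := ρ) hK hC x k y,
    ← integral_const_mul]
  refine integral_congr_ae (Eventually.of_forall fun η' => ?_)
  dsimp only
  ring

/-- **Trace formula for the cycle with a complex kernel (periodic boundary conditions).** Let `K`
be a bounded measurable complex kernel on a finite measure space `(Y, ρ)`,
`κ f = ∫ K(·, z) f(z) dρ(z)`, and `F`, `G` bounded measurable complex one-site observables. On the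
cycle of `N = k + 1 + n' + 1` sites with the periodic weight `∏_{t : Fin N} K(V t, V (t+1))`,
inserting `F` at site `0` and `G` at the site `p` with `p = n' + 1`,
`∫ F(V 0) G(V p) ∏_t K(V t, V (t+1)) dρ^{⊗N}(V) = ∫ F(x) · (κ^[n'+1] (y ↦ G(y) · (κ^[k] K(·, x))(y)))(x) dρ(x)`
(port of `integral_cyclic_eq_integral_iterate`). [folklore] -/
theorem integral_cyclic_eq_integral_iterateC (hK : Measurable (uncurry K))
    (hC : ∀ x y, ‖K x y‖ ≤ C) (k n' : ℕ) {F G : Y → ℂ} (hF : Measurable F) (hG : Measurable G)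
    {BF BG : ℝ} (hFb : ∀ y, ‖F y‖ ≤ BF) (hGb : ∀ y, ‖G y‖ ≤ BG) (p : Fin (k + 1 + n' + 1))
    (hp : (p : ℕ) = n' + 1) :
    ∫ V : Fin (k + 1 + n' + 1) → Y, F (V 0) * G (V p) * ∏ t, K (V t) (V (t + 1))
        ∂(Measure.pi fun _ => ρ) =
      ∫ x, F x * (fun f : Y → ℂ => fun w => ∫ z, K w z * f z ∂ρ)^[n' + 1]
        (fun y => G y * (fun f : Y → ℂ => fun w => ∫ z, K w z * f z ∂ρ)^[k] (fun z => K z x) y) x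
        ∂ρ := by
  -- the insertion site `p` is the successor of the open-path site `(0 : Fin (k+1)).addNat n'`
  have hpG : p = ((0 : Fin (k + 1)).addNat n').succ := Fin.ext (by simp [hp])
  -- Step 1: cut the cycle at site `0` (Fubini along `Fin.cons`)
  have hΦm : Measurable fun V : Fin (k + 1 + n' + 1) → Y =>
      F (V 0) * G (V p) * ∏ t, K (V t) (V (t + 1)) := by
    refine ((hF.comp (measurable_pi_apply 0)).mul (hG.comp (measurable_pi_apply p))).mul ?_
    refine Finset.measurable_prod _ fun t _ => ?_
    have h := hK.comp ((measurable_pi_apply (X := fun _ : Fin (k + 1 + n' + 1) => Y) t).prodMk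
      (measurable_pi_apply (X := fun _ : Fin (k + 1 + n' + 1) => Y) (t + 1)))
    exact h
  have hΦb : ∀ V : Fin (k + 1 + n' + 1) → Y,
      ‖F (V 0) * G (V p) * ∏ t, K (V t) (V (t + 1))‖ ≤ BF * BG * C ^ (k + 1 + n' + 1) := by
    intro V
    have hBF : 0 ≤ BF := (norm_nonneg _).trans (hFb (V 0))
    have hBG : 0 ≤ BG := (norm_nonneg _).trans (hGb (V p))
    have hP : ‖∏ t, K (V t) (V (t + 1))‖ ≤ C ^ (k + 1 + n' + 1) := by
      calc ‖∏ t, K (V t) (V (t + 1))‖ ≤ ∏ t, ‖K (V t) (V (t + 1))‖ := Finset.norm_prod_le _ _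
        _ ≤ ∏ _t : Fin (k + 1 + n' + 1), C :=
            Finset.prod_le_prod (fun t _ => norm_nonneg _) fun t _ => hC _ _
        _ = C ^ (k + 1 + n' + 1) := by simp
    rw [norm_mul, norm_mul]
    exact mul_le_mul (mul_le_mul (hFb _) (hGb _) (norm_nonneg _) hBF) hP (norm_nonneg _)
      (mul_nonneg hBF hBG)
  rw [integral_pi_succ_eq_integral_consC (ρ := ρ) (k + 1 + n') hΦm hΦb]
  refine integral_congr_ae (Eventually.of_forall fun x => ?_)
  dsimp only
  -- Step 2: the integrand on the open path `ζ` with boundary spin `x`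
  have hKx : Measurable fun z => K z x := hK.comp (measurable_id.prodMk measurable_const)
  have hObsm : Measurable fun η : Fin (k + 1) → Y => G (η 0) * K (η (Fin.last k)) x :=
    (hG.comp (measurable_pi_apply 0)).mul (hKx.comp (measurable_pi_apply _))
  have hObsb : ∀ η : Fin (k + 1) → Y, ‖G (η 0) * K (η (Fin.last k)) x‖ ≤ BG * C := fun η => by
    rw [norm_mul]
    exact mul_le_mul (hGb _) (hC _ _) (norm_nonneg _) ((norm_nonneg _).trans (hGb (η 0)))
  have hcut : ∀ ζ : Fin (k + 1 + n') → Y,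
      F ((Fin.cons x ζ : Fin (k + 1 + n' + 1) → Y) 0) *
          G ((Fin.cons x ζ : Fin (k + 1 + n' + 1) → Y) p) *
          ∏ t, K ((Fin.cons x ζ : Fin (k + 1 + n' + 1) → Y) t)
            ((Fin.cons x ζ : Fin (k + 1 + n' + 1) → Y) (t + 1)) =
        F x * ((∏ i : Fin (k + 1 + n'),
          K ((Fin.cons x ζ : Fin (k + 1 + n' + 1) → Y) (Fin.castSucc i)) (ζ i)) *
          (fun η : Fin (k + 1) → Y => G (η 0) * K (η (Fin.last k)) x)
            fun i => ζ (i.addNat n')) := by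
    intro ζ
    rw [prod_cyclic_consC K k n' x ζ, Fin.cons_zero, hpG, Fin.cons_succ]
    ring
  simp_rw [hcut]
  rw [integral_const_mul]
  congr 1
  -- Step 3: peel the `n'` sites of the first arc; Step 4: the remaining block of `k + 1` sites
  rw [integral_pathWeightC_eq_iterate (ρ := ρ) hK hC (k + 1) hObsm hObsb n' x,
    Function.iterate_succ_apply]
  beta_reduce
  rw [integral_pathWeightC_obs_mul_kernel_last_eq (ρ := ρ) hK hC k hG hGb x]

end StubCyclicPeelC

/-- **Sub-goal A1 of line `twisted_trace_transfer` (registered stub `stub_cyclicPeelC`; port of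
`Literature.Analysis.OperatorTheory.integral_cyclic_eq_integral_iterate` to COMPLEX kernels).**
For a bounded measurable kernel `K : Y → Y → ℂ` on a finite measure space, bounded measurable
one-site observables `F`, `G`, on the cycle of `N = k + 1 + n' + 1` sites with the periodic weight
`∏_t K(V t, V (t+1))`, inserting `F` at site `0` and `G` at the site `p = n' + 1`:
`∫ F(V 0) G(V p) ∏_t K(V t, V (t+1)) dρ^{⊗N} = ∫ F(x) (κ^[n'+1] (y ↦ G(y) (κ^[k] K(·, x))(y)))(x) dρ(x)`,
`κ f = ∫ K(·, z) f(z) dρ(z)` — the path-space form of `Tr(F 𝕋^{n'+1} G 𝕋^{k+1})`.  Proof: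
`StubCyclicPeelC.integral_cyclic_eq_integral_iterateC` (Fubini along `Fin.cons`,
`measurePreserving_piFinSuccAbove`). [folklore] -/
theorem stub_cyclicPeelC : ∀ (Y : Type) [MeasurableSpace Y] (ρ : Measure Y) [IsFiniteMeasure ρ]
    (K : Y → Y → ℂ) (C : ℝ), Measurable (Function.uncurry K) → (∀ x y, ‖K x y‖ ≤ C) →
    ∀ (k n' : ℕ) (F G : Y → ℂ) (BF BG : ℝ), Measurable F → Measurable G →
      (∀ y, ‖F y‖ ≤ BF) → (∀ y, ‖G y‖ ≤ BG) → ∀ p : Fin (k + 1 + n' + 1), (p : ℕ) = n' + 1 →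
      ∫ V : Fin (k + 1 + n' + 1) → Y, F (V 0) * G (V p) * ∏ t, K (V t) (V (t + 1)) ∂(Measure.pi fun _ => ρ) =
        ∫ x, F x * (fun f : Y → ℂ => fun w => ∫ z, K w z * f z ∂ρ)^[n' + 1]
          (fun y => G y * (fun f : Y → ℂ => fun w => ∫ z, K w z * f z ∂ρ)^[k] (fun z => K z x) y) x ∂ρ := by
  intro Y _ ρ _ K C hK hC k n' F G BF BG hF hG hFb hGb p hp
  exact StubCyclicPeelC.integral_cyclic_eq_integral_iterateC hK hC k n' hF hG hFb hGb p hp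

end Summit.QuantumFields.QCD.Cruxes.StableActionBridge.TwistedTraceTransfer
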